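import Literature.NumberTheory.LFunctions.Zhang2022.KnifeEdgeEllThinBDHZhang

/-!
# §D edge ell — card `prime-discharge-thin-bdh`: the REPAIRED bridge hypothesis of record `ThinBDHAllAt` (the ℓ-side
# variance over ALL moduli `q = D·m`, large-conductor part `r ∣ D·m`, `r ≥ D³`) and `ThinBDHBridgeAll`
# (critic F-ℓ13, custodian ruling ELL-CENSUS (γ) sharpened)

Y. Zhang, *Discrete mean estimates and the Landau–Siegel zero*, arXiv:2211.02515v1 [Zhang2022LandauSiegel] — an
unrefereed manuscript under adjudication. **WHAT THIS IS NOT: not a claim about Theorems 1–2 of arXiv:2211.02515, about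
Landau–Siegel zeros, about Parity, or about a repaired `Margin232`; `ThinBDHAllAt`, `ThinBDHAll`, `ThinBDHBridgeAll`,
`ThinBDHAllZhang(At)` are bare `Prop`s asserted by no one (the card is CLOSED `reduces-to`, ledger 7fc783af00ce, grade
variant; its typed rungs stay as §E / B-ell E-016′ material). The programme SEARCHES and TYPES; no claim about
Landau–Siegel zeros, Theorems 1–2 of arXiv:2211.02515 or a repaired Margin232 until a kernel theorem says so.**
(LANDAU–SIEGEL programme F-S3, cell `landau-siegel`, §D edge ell; typer ls-knife-typer-2 g4; companion of
`KnifeEdgeEllThinBDH` (p489286: `ThinBDHAt`, `ThinBDHBridge`, E-016′) and `KnifeEdgeEllThinBDHZhang` (p493151).)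

## Why (critic ls-knife-crit-2 g4, F-ℓ13, cell INBOX 2026-08-27T03:16:36Z / 03:21:16Z; custodian ls-theory g2 03:22:06Z (3))

`ThinBDHAt A B c κ` (p489286) states the card's variance on twists mod `D` × additive characters `a/m` with
`(m, D) = 1` — functions of `ℓ mod D·m`, `(m,D) = 1`, only — whereas `FaithfulBoundFor`'s range `largeConductorRange`
(ALL `r ∈ [D³, 2DP₄)` with the `h`-filter `D/(D,r) ∣ h`) also contains the primitive conductors `r = p·D·r″`, `p ∣ D`.
So `ThinBDHBridge A B` as typed asks a too-thin family to control a strictly larger one (critic: presumably false as typed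
for `B < ½` — desk, refuter lane). CUSTODIAN RULING (typing of record, ELL-CENSUS (γ) sharpened): «a design's ThinBDH(κ*)
is stated on the variance over ALL `q = D·m`, `m ∈ (M, 2M]` — no coprimality filter, no CRT split, no twist set;
generic/GRH window `B > ¼ + c/2` and family size `≍ D·M²` unchanged». The critic's typing suggestion (03:31:28Z), adopted
here: the MULTIPLICATIVE large-conductor form, which is what the bridge's Cauchy–Schwarz-over-`p` step actually produces
and mirrors `u017MajorantAt`'s own index set (`hr = Dk`, `r ≥ D³`, `(ℓ, hr) = 1`) — by Parseval it equals the custodian's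
`V(q) = Σ_{b mod q}|C_b − M_b|²` with `M_b` the projection onto characters of conductor `< D³`.

## What is typed (statements; two one-line compositions)

* `thinVarianceLC κ d D τ N M := Σ_{m ∈ (M,2M]} Σ_{r ∣ D·m, r ≥ D³} ((D·m)/φ(D·m)) Σ*_{θ mod r primitive}
  |Σ_{N<ℓ≤2N, (ℓ, D·m)=1} κ(dℓ)θ(ℓ)ℓ^{iτ}|²` — ALL moduli `m` (no `(m,D) = 1`), every large-conductor primitive `θ`
  induced to modulus `D·m` through `(ℓ, D·m) = 1`; no twist set, no CRT.
* **`ThinBDHAllAt A B c κ`** — the binders of `ThinBDHAt` verbatim (`D ≥ D₀`, `1 ≤ d ≤ 2P₄`, `|τ| ≤ 𝓛⁶⁰⁰`,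
  `M ∈ [M₀, 2P₄]`, `N = D·M·P·t₀`) with `thinVarianceLC` in place of `thinVarianceAdd … twists …`, same right side
  `C·N²·(M₀/M)·𝓛^{C′}`; `ThinBDHAll A B κ := ∃ c > 0, ThinBDHAllAt A B c κ`.
* **`ThinBDHBridgeAll A B`** — the bridge OF RECORD: `∀ κ c, 0 < c → ¼ + c < B → B < ½ → ThinBDHAllAt A B c κ →
  FaithfulBoundFor A B κ` (superseding `ThinBDHBridge` as the statement a crux chain would prove);
  `faithfulBoundFor_of_bridgeAll`.
* `ThinBDHAllZhangAt A B c c' b` / `ThinBDHAllZhang A B c' b` — the same for Zhang's family `D ↦ κ₁∗b_D`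
  (`kappaStarAt`, p493151), the card's K1 of record modulo `b`; `faithfulBoundFor_zhang_of_bridgeAll`.

Deliberately NOT here: any comparison theorem between `thinVarianceLC` and `thinVarianceAdd` (different index sets; the LC
family is the larger one on the `p ∣ D` conductors and omits the twist bookkeeping), any Gallagher/additive twin, and any
claim about the truth of either hypothesis. References: Zhang, arXiv:2211.02515v1, §14 (14.6)–(14.8) p.79 (tex L3945–L3963)
[cite: Zhang2022LandauSiegel, §14 (14.8) p.79].
-/

noncomputable section

open Complex Real

namespace Literature.NumberTheory.LFunctions.Zhang2022.KnifeEdgeEll.PrimeDischarge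

open KnifeEdge EllScales Skeleton Typed.Sec14
open scoped BigOperators

/-! ## The large-conductor multiplicative ℓ-variance over ALL moduli `q = D·m` -/

/-- **The large-conductor ℓ-variance at modulus scale `M`** (critic's `thinVarianceLC`, F-ℓ13 repair):
`Σ_{m ∈ (M,2M]} Σ_{r ∣ D·m, r ≥ D³} ((D·m)/φ(D·m)) · Σ*_{θ mod r primitive} |Σ_{N<ℓ≤2N, (ℓ,D·m)=1} κ(dℓ)θ(ℓ)ℓ^{iτ}|²` — ALL
moduli `m` (no coprimality filter), every primitive `θ` of conductor `r ≥ D³` dividing `D·m`, induced to modulus `D·m` by the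
constraint `(ℓ, D·m) = 1` (the `(l,h) = 1`, `hr = Dk` bookkeeping of (14.8) with `k = m`, `h = Dm/r`).
[cite: Zhang2022LandauSiegel, §14 (14.6)–(14.8) p.79] -/
def thinVarianceLC (κ : ℕ → ℂ) (d D : ℕ) (τ Nlen : ℝ) (M : ℕ) : ℝ :=
  ∑ m ∈ Finset.Ioc M (2 * M), ∑ r ∈ (Nat.divisors (D * m)).filter (fun r => D ^ 3 ≤ r),
    ((D * m : ℕ) : ℝ) / (Nat.totient (D * m) : ℝ) *
      ∑ θ ∈ finsetOf {θ : DirichletCharacter ℂ r | θ.IsPrimitive},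
        ‖∑ l ∈ (Finset.Ioc ⌊Nlen⌋₊ ⌊2 * Nlen⌋₊).filter (fun l => Nat.Coprime l (D * m)),
            κ (d * l) * θ (l : ZMod r) * ((l : ℂ) ^ ((τ : ℂ) * Complex.I))‖ ^ 2

/-- Every term of the large-conductor variance is non-negative. [cite: Zhang2022LandauSiegel, §14 (14.8) p.79] -/
theorem thinVarianceLC_nonneg (κ : ℕ → ℂ) (d D : ℕ) (τ Nlen : ℝ) (M : ℕ) : 0 ≤ thinVarianceLC κ d D τ Nlen M := by
  unfold thinVarianceLC
  refine Finset.sum_nonneg fun m _ => Finset.sum_nonneg fun r _ => mul_nonneg ?_ ?_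
  · exact div_nonneg (Nat.cast_nonneg _) (Nat.cast_nonneg _)
  · exact Finset.sum_nonneg fun θ _ => by positivity

/-! ## The repaired hypothesis and the bridge OF RECORD -/

/-- **`ThinBDHAllAt A B c κ` — the card's hypothesis ON the family `κ`, REPAIRED per F-ℓ13 / custodian ruling (OPEN;
asserted by no one):** the binders of `ThinBDHAt` verbatim — for some `C, C′, D₀`, all `D ≥ D₀`, all `1 ≤ d ≤ 2P₄`, all
`|τ| ≤ 𝓛⁶⁰⁰`, all modulus scales `M ∈ [M₀, 2P₄]`, with `N = D·M·P·t₀` — now bounding the large-conductor variance over ALL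
moduli `D·m`: `thinVarianceLC (κ D) d D τ N M ≤ C·N²·(M₀/M)·𝓛^{C′}`. Generic/GRH window `B > ¼ + c/2`, family size
`≍ D·M²` (critic/custodian: unchanged by the repair). [cite: Zhang2022LandauSiegel, §14 (14.6)–(14.8) p.79; §15 (15.1)–(15.2)] -/
def ThinBDHAllAt (A B c : ℝ) (κ : ℕ → ℕ → ℂ) : Prop :=
  ∃ C C' : ℝ, ∃ D₀ : ℕ, ∀ D : ℕ, D₀ ≤ D →
    ∀ d : ℕ, 1 ≤ d → (d : ℝ) ≤ 2 * (scalesAt A B D).P4 →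
    ∀ τ : ℝ, |τ| ≤ Real.log D ^ (600 : ℕ) →
    ∀ M : ℕ, M0 (scalesAt A B D) D c ≤ M → (M : ℝ) ≤ 2 * (scalesAt A B D).P4 →
      thinVarianceLC (κ D) d D τ ((D : ℝ) * M * (scalesAt A B D).P * (scalesAt A B D).t0) M
        ≤ C * ((D : ℝ) * M * (scalesAt A B D).P * (scalesAt A B D).t0) ^ 2
            * (M0 (scalesAt A B D) D c / M) * Real.log D ^ C'

/-- **`ThinBDHAll A B κ := ∃ c > 0, ThinBDHAllAt A B c κ`** — the repaired residue of the prime discharge (OPEN).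
[cite: Zhang2022LandauSiegel, §14 (14.6)–(14.8) p.79] -/
def ThinBDHAll (A B : ℝ) (κ : ℕ → ℕ → ℂ) : Prop :=
  ∃ c : ℝ, 0 < c ∧ ThinBDHAllAt A B c κ

/-- **`ThinBDHBridgeAll A B` — the BRIDGE OF RECORD (crux K2 after F-ℓ13; OPEN, asserted by no one):** for every family
`κ` and every `c > 0` with `B ∈ (¼ + c, ½)`, `ThinBDHAllAt A B c κ` implies E-016′'s conclusion `FaithfulBoundFor A B κ`
(Cauchy–Schwarz over `p ∼ P`, injectivity of `p ↦ p̄ (mod Dm)` for `Dm > 2P`, Parseval on `(ℤ/Dm)ˣ`, Mellin separation, the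
`d`-sum — with NO family mismatch: the hypothesis and `u017MajorantAt` index the same conductors `r ≥ D³`, `r ∣ Dm`). It
supersedes `ThinBDHBridge` (p489286) as the statement a proof would target. [cite: Zhang2022LandauSiegel, §14 (14.5)–(14.8) pp.78–79] -/
def ThinBDHBridgeAll (A B : ℝ) : Prop :=
  ∀ κ : ℕ → ℕ → ℂ, ∀ c : ℝ, 0 < c → 1 / 4 + c < B → B < 1 / 2 → ThinBDHAllAt A B c κ → FaithfulBoundFor A B κ

/-- One-line composition: a TRUE repaired bridge and the repaired hypothesis on the window give E-016′'s conclusion for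
that family. [cite: Zhang2022LandauSiegel, §14 (14.8) p.79] -/
theorem faithfulBoundFor_of_bridgeAll {A B c : ℝ} {κ : ℕ → ℕ → ℂ} (hbr : ThinBDHBridgeAll A B) (hc : 0 < c)
    (hB : 1 / 4 + c < B) (hB' : B < 1 / 2) (hκ : ThinBDHAllAt A B c κ) : FaithfulBoundFor A B κ :=
  hbr κ c hc hB hB' hκ

/-- The priced `∀κ` form E-016′ gives `FaithfulBoundFor` for every family, so it would make the repaired bridge hold
VACUOUSLY in its hypothesis — recorded only to locate the logical position (that `∀κ` form is the refuter's target,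
BN-ℓ8, and is not a design hypothesis). [cite: Zhang2022LandauSiegel, §14 (14.8) p.79] -/
theorem thinBDHBridgeAll_of_uncond {A B : ℝ} (h : Eq148DUniformFaithfulUncond A B) : ThinBDHBridgeAll A B :=
  fun κ _ _ _ _ _ => faithfulBoundFor_all_of_uncond h κ

/-! ## Zhang's family: the card's K1 of record, modulo `b` -/

/-- **K1 of record, modulo `b`, saving displayed (OPEN):** `ThinBDHAllAt A B c` for `D ↦ κ₁∗b_D` at `scalesAt A B D`
(`kappaStarAt`, p493151; `b : D ↦ b_D` the (12.2)/(15.2) coefficient family, an explicit argument — its free-scale twin is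
not typed). [cite: Zhang2022LandauSiegel, §14 (14.8) p.79; §15 p.81, (15.1)–(15.2)] -/
def ThinBDHAllZhangAt (A B c c' : ℝ) (b : ℕ → ℕ → ℂ) : Prop :=
  ThinBDHAllAt A B c fun D => kappaStarAt c' (scalesAt A B D) (b D)

/-- **K1 of record, modulo `b` (OPEN):** `ThinBDHAll A B (D ↦ κ₁∗b_D)`. [cite: Zhang2022LandauSiegel, §14 (14.8) p.79; §15 p.81] -/
def ThinBDHAllZhang (A B c' : ℝ) (b : ℕ → ℕ → ℂ) : Prop :=
  ThinBDHAll A B fun D => kappaStarAt c' (scalesAt A B D) (b D)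

/-- Unfolding. [cite: Zhang2022LandauSiegel, §14 (14.8) p.79] -/
theorem thinBDHAllZhang_iff (A B c' : ℝ) (b : ℕ → ℕ → ℂ) :
    ThinBDHAllZhang A B c' b ↔ ∃ c : ℝ, 0 < c ∧ ThinBDHAllZhangAt A B c c' b := Iff.rfl

/-- **The route's one-line assembly for E4, of record:** repaired bridge ∘ repaired K1 on the window `B ∈ (¼ + c, ½)` ⇒
E-016′'s conclusion for Zhang's family `κ₁∗b`. [cite: Zhang2022LandauSiegel, §14 (14.5)–(14.8) pp.78–79] -/
theorem faithfulBoundFor_zhang_of_bridgeAll {A B c c' : ℝ} {b : ℕ → ℕ → ℂ} (hbr : ThinBDHBridgeAll A B) (hc : 0 < c)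
    (hB : 1 / 4 + c < B) (hB' : B < 1 / 2) (hX : ThinBDHAllZhangAt A B c c' b) :
    FaithfulBoundFor A B fun D => kappaStarAt c' (scalesAt A B D) (b D) :=
  faithfulBoundFor_of_bridgeAll hbr hc hB hB' hX

end Literature.NumberTheory.LFunctions.Zhang2022.KnifeEdgeEll.PrimeDischarge
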